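import Summits.CriticalPhenomena.PercolationContinuityZ3.Theorems.PercNearOneGluingNoHeavyLowerTailSahiCTCC2LevelTwoPrep
import Summits.CriticalPhenomena.PercolationContinuityZ3.Theorems.PercNearOneGluingNoHeavyLowerTailSahiCTCLadderNested
import HarnessLib

/-!
# `NoHeavyLowerTail` (crux stmt-CriticalPhenomena-4575), P3 lane: the C2 difference of `R_2` at a vertex — THREE IDENTITIES
# (generic vertex / loop of both / loop of one side) for `P₂ − P₃ = RlumpVx D 𝒳 𝒵 v 2 − RlumpVx D 𝒳 𝒵 v 3`, `D = {S : #S < 2}`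

Support file (seat `prim-l12-p3`, gen 42; `--supports stmt-CriticalPhenomena-4575`).  Memo
`run/shared/lean/prim/prim-l12/FROM-prim-l12-p3-g42-C2-LEVEL-TWO.md` §2.  The one-vertex expansion `R_D = Σ_j s_v^j P_j` of `…SahiCTCLumpedVertex`
(`P_j = RlumpVx D 𝒳 𝒵 v j`) specialised to the threshold-2 family `D = bySize (· < 2)`: `linkV v D = {∅}`, the small members of a link / deletion are
explicit (`linkV_bySize_lt_two`, `linkV_filter_mem_bySize_eq_empty`, `linkV_filter_mem_bySize_eq_singleton`, `linkV_inter_filter_not_mem_bySize`,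
`linkV_eq_delV_powerset`), and with `x, x'` = GF of `delV v 𝒳`, `linkV v 𝒳` (likewise `z, z'`), `Π' = GF(delV v 2^α)`,
`H⁰ = Π'·GF(delV 𝒳 ∩ delV 𝒵) − x·z`, `H¹ = Π'·GF(linkV 𝒳 ∩ linkV 𝒵) − x'·z'`:
* `RlumpVx_two_sub_three_generic` (`{v} ∉ 𝒳`, `{v} ∉ 𝒵`): `P₂ − P₃ = GF(delV D)·H¹ + H⁰ + (x'−x)(z'−z) − Π'·GF({S ∈ delV 𝒳 ∩ delV 𝒵 : #S < 2})`
  (memo g27 §4.2's `G_2`, rewritten: the "crossed Harris form" `Π'Y⁰ + Π'Y¹ − X⁰Z¹ − X¹Z⁰` equals `H⁰ + H¹ + (x'−x)(z'−z)`);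
* `RlumpVx_two_sub_three_loops` (`{v} ∈ 𝒳 ∩ 𝒵`): `P₂ − P₃ = Π'·GF({S : v ∉ S, #S ≥ 2, S ∉ 𝒳, S ∉ 𝒵})`;
* `RlumpVx_two_sub_three_loop` (`{v} ∈ 𝒳`, `{v} ∉ 𝒵`): `P₂ − P₃ = GF(delV 2^α ∖ delV 𝒳)·GF(linkV 𝒵) − Π'·GF({S ∈ delV 𝒵 : #S ≥ 2, S ∉ 𝒳})`;
* `RlumpVx_two_sub_three_comm` : the difference is symmetric in the pair.
The nonnegativity of the three right-hand sides and C2 at `t = 2` itself are in `…SahiCTCC2LevelTwo`.  Nothing is asserted about the crux.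
-/

noncomputable section

open scoped Classical

namespace Summit.CriticalPhenomena.PercolationContinuityZ3.Theorems.SahiCTCForms

open Finset MvPolynomial SahiCTCGenFun

variable {α : Type*} [DecidableEq α] [Fintype α]

/-! ### The threshold-2 lumped family at a vertex -/

section Vertex
variable (F G : Finset (Finset α)) (v : α)

omit [Fintype α] in
/-- `delV` of a filtered family. [this work] -/
theorem delV_filter (p : Finset α → Prop) [DecidablePred p] : delV v (F.filter p) = (delV v F).filter p := by
  unfold delV; rw [filter_filter, filter_filter]; exact filter_congr fun S _ => and_comm

/-- `linkV` of a filtered family. [this work] -/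
theorem linkV_filter (p : Finset α → Prop) [DecidablePred p] :
    linkV v (F.filter p) = (linkV v F).filter fun S => p (insert v S) := by
  unfold linkV; rw [filter_filter]; exact filter_congr fun S _ => by rw [mem_filter]

omit [DecidableEq α] in
/-- Membership in `bySize`. [this work] -/
theorem mem_bySize_iff (p : ℕ → Prop) [DecidablePred p] (S : Finset α) : S ∈ (bySize p : Finset (Finset α)) ↔ p #S := by
  unfold bySize; simp only [mem_filter, mem_powerset, subset_univ, true_and]

omit [Fintype α] in
/-- For a set `S` avoiding `v`: `#(S + v) < 2 ↔ S = ∅`. [this work] -/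
theorem card_insert_lt_two_iff {v : α} {S : Finset α} (h : v ∉ S) : #(insert v S) < 2 ↔ S = ∅ := by
  rw [card_insert_of_notMem h, ← card_eq_zero]; omega

/-- The link of the threshold-2 family is `{∅}`. [this work] -/
theorem linkV_bySize_lt_two : linkV v (bySize (· < 2) : Finset (Finset α)) = {∅} := by
  ext S
  simp only [linkV, mem_filter, mem_powerset, subset_erase, subset_univ, true_and, mem_bySize_iff, mem_singleton]
  constructor
  · rintro ⟨hv, h⟩; exact (card_insert_lt_two_iff hv).1 h
  · rintro rfl; exact ⟨notMem_empty v, by rw [insert_empty, card_singleton]; omega⟩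

/-- An up-set not containing `{v}` has no member `S + v` of size `< 2`. [this work] -/
theorem linkV_filter_mem_bySize_eq_empty (hv : ({v} : Finset α) ∉ F) :
    linkV v (F.filter fun S => S ∈ (bySize (· < 2) : Finset (Finset α))) = ∅ := by
  rw [linkV_filter]
  refine filter_eq_empty_iff.2 fun S hS h => ?_
  rw [mem_bySize_iff, card_insert_lt_two_iff (not_mem_of_mem_linkV hS)] at h
  subst h
  rw [linkV, mem_filter, insert_empty] at hS
  exact hv hS.2

/-- For up-sets with `{v} ∉ F`: the members `S + v ∈ F ∩ G` of size `≥ 2` are all of `linkV F ∩ linkV G`. [this work] -/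
theorem linkV_inter_filter_not_mem_bySize (hv : ({v} : Finset α) ∉ F) :
    linkV v ((F ∩ G).filter fun S => S ∉ (bySize (· < 2) : Finset (Finset α))) = linkV v F ∩ linkV v G := by
  rw [linkV_filter, linkV_inter]
  refine filter_true_of_mem fun S hS h => ?_
  have hSF : S ∈ linkV v F := (mem_inter.1 hS).1
  rw [mem_bySize_iff, card_insert_lt_two_iff (not_mem_of_mem_linkV hSF)] at h
  subst h
  rw [linkV, mem_filter, insert_empty] at hSF
  exact hv hSF.2

/-- If `{v} ∈ F` (up-set) then every set avoiding `v` is in the link. [this work] -/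
theorem linkV_eq_delV_powerset (hF : IsUpperSet (F : Set (Finset α))) (hv : ({v} : Finset α) ∈ F) :
    linkV v F = delV v (univ.powerset : Finset (Finset α)) := by
  rw [← linkV_powerset_eq]
  ext S
  simp only [linkV, mem_filter, mem_powerset, subset_univ, and_true]
  exact ⟨fun h => h.1, fun h => ⟨h, hF (by simp) hv⟩⟩

/-- If `{v} ∈ F` then the members `S + v ∈ F` of size `< 2` are exactly `S = ∅`. [this work] -/
theorem linkV_filter_mem_bySize_eq_singleton (hF : IsUpperSet (F : Set (Finset α))) (hv : ({v} : Finset α) ∈ F) :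
    linkV v (F.filter fun S => S ∈ (bySize (· < 2) : Finset (Finset α))) = {∅} := by
  rw [linkV_filter, linkV_eq_delV_powerset F v hF hv]
  ext S
  simp only [mem_filter, delV, mem_powerset, subset_univ, true_and, mem_bySize_iff, mem_singleton]
  constructor
  · rintro ⟨hvS, h⟩; exact (card_insert_lt_two_iff hvS).1 h
  · rintro rfl; exact ⟨notMem_empty v, by rw [insert_empty, card_singleton]; omega⟩

end Vertex

/-! ### The C2 difference of `R_2` at a vertex: the three identities -/

section Identities
variable {F G : Finset (Finset α)} {v : α}

/-- **Generic vertex** (`{v} ∉ 𝒳`, `{v} ∉ 𝒵`): `P₂ − P₃ = GF(delV D)·H¹ + H⁰ + (x'−x)(z'−z) − Π'·GF(common small sets avoiding v)`. [this work] -/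
theorem RlumpVx_two_sub_three_generic (hvF : ({v} : Finset α) ∉ F) (hvG : ({v} : Finset α) ∉ G) :
    RlumpVx (bySize (· < 2)) F G v 2 - RlumpVx (bySize (· < 2)) F G v 3 =
      gf (delV v (bySize (· < 2) : Finset (Finset α)))
          * (gf (delV v (univ.powerset : Finset (Finset α))) * gf (linkV v F ∩ linkV v G) - gf (linkV v F) * gf (linkV v G))
        + (gf (delV v (univ.powerset : Finset (Finset α))) * gf (delV v F ∩ delV v G) - gf (delV v F) * gf (delV v G))
        + (gf (linkV v F) - gf (delV v F)) * (gf (linkV v G) - gf (delV v G))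
        - gf (delV v (univ.powerset : Finset (Finset α)))
          * gf ((delV v F ∩ delV v G).filter fun S => S ∈ (bySize (· < 2) : Finset (Finset α))) := by
  have h1 : gf (linkV v (bySize (· < 2) : Finset (Finset α))) = 1 := by rw [linkV_bySize_lt_two, gf_singleton_empty]
  have h2 : gf (linkV v (F.filter fun S => S ∈ (bySize (· < 2) : Finset (Finset α)))) = 0 := by
    rw [linkV_filter_mem_bySize_eq_empty F v hvF, gf_empty]
  have h3 : gf (linkV v (G.filter fun S => S ∈ (bySize (· < 2) : Finset (Finset α)))) = 0 := by
    rw [linkV_filter_mem_bySize_eq_empty G v hvG, gf_empty]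
  have h4 : gf (linkV v ((F ∩ G).filter fun S => S ∉ (bySize (· < 2) : Finset (Finset α)))) = gf (linkV v F ∩ linkV v G) := by
    rw [linkV_inter_filter_not_mem_bySize F G v hvF]
  have h5 : gf (delV v ((F ∩ G).filter fun S => S ∉ (bySize (· < 2) : Finset (Finset α))))
      = gf (delV v F ∩ delV v G) - gf ((delV v F ∩ delV v G).filter fun S => S ∈ (bySize (· < 2) : Finset (Finset α))) := by
    rw [delV_filter, delV_inter, eq_sub_iff_add_eq, add_comm, gf_filter_add_gf_filter_not]
  simp only [RlumpVx]
  rw [h1, h2, h3, h4, h5]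
  ring

/-- **Vertex that is a loop of both** (`{v} ∈ 𝒳 ∩ 𝒵`): `P₂ − P₃ = Π'·GF({S : v ∉ S, #S ≥ 2, S ∉ 𝒳, S ∉ 𝒵})`. [this work] -/
theorem RlumpVx_two_sub_three_loops (hF : IsUpperSet (F : Set (Finset α))) (hG : IsUpperSet (G : Set (Finset α)))
    (hvF : ({v} : Finset α) ∈ F) (hvG : ({v} : Finset α) ∈ G) :
    RlumpVx (bySize (· < 2)) F G v 2 - RlumpVx (bySize (· < 2)) F G v 3 =
      gf (delV v (univ.powerset : Finset (Finset α)))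
        * gf (((delV v (univ.powerset : Finset (Finset α))).filter fun S => S ∉ (bySize (· < 2) : Finset (Finset α))).filter
            fun S => S ∉ F ∧ S ∉ G) := by
  obtain ⟨U', hU'⟩ : ∃ U' : Finset (Finset α), U' = delV v (univ.powerset : Finset (Finset α)) := ⟨_, rfl⟩
  obtain ⟨P2, hP2⟩ : ∃ P2 : Finset (Finset α), P2 = U'.filter fun S => S ∉ (bySize (· < 2) : Finset (Finset α)) := ⟨_, rfl⟩
  have hmemU' : ∀ S : Finset α, S ∈ U' ↔ v ∉ S := fun S => by
    rw [hU']; simp only [delV, mem_filter, mem_powerset, subset_univ, true_and]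
  have h1 : gf (linkV v (bySize (· < 2) : Finset (Finset α))) = 1 := by rw [linkV_bySize_lt_two, gf_singleton_empty]
  have hxF : gf (linkV v F) = gf U' := by rw [hU', linkV_eq_delV_powerset F v hF hvF]
  have hxG : gf (linkV v G) = gf U' := by rw [hU', linkV_eq_delV_powerset G v hG hvG]
  have h2 : gf (linkV v (F.filter fun S => S ∈ (bySize (· < 2) : Finset (Finset α)))) = 1 := by
    rw [linkV_filter_mem_bySize_eq_singleton F v hF hvF, gf_singleton_empty]
  have h3 : gf (linkV v (G.filter fun S => S ∈ (bySize (· < 2) : Finset (Finset α)))) = 1 := by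
    rw [linkV_filter_mem_bySize_eq_singleton G v hG hvG, gf_singleton_empty]
  have h4 : gf (linkV v ((F ∩ G).filter fun S => S ∉ (bySize (· < 2) : Finset (Finset α)))) = gf U' - 1 := by
    rw [linkV_filter, linkV_inter, linkV_eq_delV_powerset F v hF hvF, linkV_eq_delV_powerset G v hG hvG, inter_self, ← hU',
      eq_sub_iff_add_eq]
    have hsplit := gf_filter_add_gf_filter_not U' (fun S => insert v S ∉ (bySize (· < 2) : Finset (Finset α)))
    have hrest : U'.filter (fun S => ¬ insert v S ∉ (bySize (· < 2) : Finset (Finset α))) = {∅} := by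
      ext S
      simp only [not_not, mem_filter, hmemU', mem_bySize_iff, mem_singleton]
      constructor
      · rintro ⟨hvS, h⟩; exact (card_insert_lt_two_iff hvS).1 h
      · rintro rfl; exact ⟨notMem_empty v, by rw [insert_empty, card_singleton]; omega⟩
    rw [hrest, gf_singleton_empty] at hsplit
    exact hsplit
  have ha : gf (delV v (bySize (· < 2) : Finset (Finset α))) = gf U' - gf P2 := by
    have : delV v (bySize (· < 2) : Finset (Finset α)) = U'.filter fun S => ¬ S ∉ (bySize (· < 2) : Finset (Finset α)) := by
      ext S; simp only [delV, bySize, mem_filter, mem_powerset, subset_univ, true_and, hmemU', not_not]; tauto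
    rw [this, eq_sub_iff_add_eq, hP2, add_comm, gf_filter_add_gf_filter_not]
  have hdelF : delV v F = U'.filter fun S => S ∈ F := by
    ext S; simp only [delV, mem_filter, hmemU']; tauto
  have hdelG : delV v G = U'.filter fun S => S ∈ G := by
    ext S; simp only [delV, mem_filter, hmemU']; tauto
  have hp : gf (delV v (F.filter fun S => S ∈ (bySize (· < 2) : Finset (Finset α))))
      = gf (delV v F) - gf (P2.filter fun S => S ∈ F) := by
    rw [delV_filter, eq_sub_iff_add_eq, hP2, Finset.filter_comm, ← hdelF, gf_filter_add_gf_filter_not]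
  have hq : gf (delV v (G.filter fun S => S ∈ (bySize (· < 2) : Finset (Finset α))))
      = gf (delV v G) - gf (P2.filter fun S => S ∈ G) := by
    rw [delV_filter, eq_sub_iff_add_eq, hP2, Finset.filter_comm, ← hdelG, gf_filter_add_gf_filter_not]
  have hc : gf (delV v ((F ∩ G).filter fun S => S ∉ (bySize (· < 2) : Finset (Finset α))))
      = gf ((P2.filter fun S => S ∈ F).filter fun S => S ∈ G) := by
    rw [delV_filter, hP2]
    congr 1; ext S; simp only [delV, mem_filter, mem_inter, hmemU']; tauto
  -- inclusion–exclusion inside `P2`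
  have s1 := gf_filter_add_gf_filter_not P2 (fun S => S ∈ F)
  have s3 := gf_filter_add_gf_filter_not (P2.filter fun S => ¬ S ∈ F) (fun S => S ∈ G)
  have s4 := gf_filter_add_gf_filter_not (P2.filter fun S => S ∈ G) (fun S => S ∈ F)
  rw [Finset.filter_comm] at s4
  have e2 : (P2.filter fun S => S ∈ G).filter (fun S => ¬ S ∈ F) = (P2.filter fun S => ¬ S ∈ F).filter fun S => S ∈ G :=
    Finset.filter_comm _ _ _
  rw [e2] at s4
  have hN : gf (P2.filter fun S => S ∉ F ∧ S ∉ G) = gf (P2.filter fun S => ¬ S ∈ F) - gf ((P2.filter fun S => ¬ S ∈ F).filter fun S => S ∈ G) := by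
    rw [eq_sub_iff_add_eq, add_comm, ← Finset.filter_filter, s3]
  simp only [RlumpVx]
  rw [h1, hxF, hxG, h2, h3, h4, ha, hp, hq, hc, ← hU', ← hP2, hN]
  linear_combination (-(gf U')) * s1 + (gf U') * s4

/-- **Vertex that is a loop of `𝒳` only** (`{v} ∈ 𝒳`, `{v} ∉ 𝒵`):
`P₂ − P₃ = GF(delV 2^α ∖ delV 𝒳)·GF(linkV 𝒵) − Π'·GF({S ∈ delV 𝒵 : #S ≥ 2, S ∉ 𝒳})`. [this work] -/
theorem RlumpVx_two_sub_three_loop (hF : IsUpperSet (F : Set (Finset α)))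
    (hvF : ({v} : Finset α) ∈ F) (hvG : ({v} : Finset α) ∉ G) :
    RlumpVx (bySize (· < 2)) F G v 2 - RlumpVx (bySize (· < 2)) F G v 3 =
      gf (delV v (univ.powerset : Finset (Finset α)) \ delV v F) * gf (linkV v G)
        - gf (delV v (univ.powerset : Finset (Finset α)))
          * gf (((delV v G).filter fun S => S ∉ (bySize (· < 2) : Finset (Finset α))).filter fun S => S ∉ F) := by
  obtain ⟨U', hU'⟩ : ∃ U' : Finset (Finset α), U' = delV v (univ.powerset : Finset (Finset α)) := ⟨_, rfl⟩
  have h1 : gf (linkV v (bySize (· < 2) : Finset (Finset α))) = 1 := by rw [linkV_bySize_lt_two, gf_singleton_empty]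
  have hxF : gf (linkV v F) = gf U' := by rw [hU', linkV_eq_delV_powerset F v hF hvF]
  have h2 : gf (linkV v (F.filter fun S => S ∈ (bySize (· < 2) : Finset (Finset α)))) = 1 := by
    rw [linkV_filter_mem_bySize_eq_singleton F v hF hvF, gf_singleton_empty]
  have h3 : gf (linkV v (G.filter fun S => S ∈ (bySize (· < 2) : Finset (Finset α)))) = 0 := by
    rw [linkV_filter_mem_bySize_eq_empty G v hvG, gf_empty]
  have h4 : gf (linkV v ((F ∩ G).filter fun S => S ∉ (bySize (· < 2) : Finset (Finset α)))) = gf (linkV v G) := by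
    rw [inter_comm, linkV_inter_filter_not_mem_bySize G F v hvG, linkV_eq_delV_powerset F v hF hvF,
      inter_eq_left.2 (fun S hS => ?_)]
    exact mem_filter.2 ⟨mem_powerset.2 (subset_univ _), not_mem_of_mem_linkV hS⟩
  have hN : gf (U' \ delV v F) = gf U' - gf (delV v F) := by
    rw [eq_sub_iff_add_eq, ← gf_union sdiff_disjoint, sdiff_union_of_subset]
    intro S hS; rw [hU']; exact mem_filter.2 ⟨mem_powerset.2 (subset_univ _), not_mem_of_mem_delV hS⟩
  have hq : gf (delV v (G.filter fun S => S ∈ (bySize (· < 2) : Finset (Finset α))))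
      = gf (delV v G) - gf ((delV v G).filter fun S => S ∉ (bySize (· < 2) : Finset (Finset α))) := by
    rw [delV_filter, eq_sub_iff_add_eq, gf_filter_add_gf_filter_not]
  have hc : gf (delV v ((F ∩ G).filter fun S => S ∉ (bySize (· < 2) : Finset (Finset α))))
      = gf (((delV v G).filter fun S => S ∉ (bySize (· < 2) : Finset (Finset α))).filter fun S => S ∈ F) := by
    rw [delV_filter, delV_inter]
    congr 1; ext S; simp only [mem_filter, mem_inter, delV]; tauto
  have s1 := gf_filter_add_gf_filter_not ((delV v G).filter fun S => S ∉ (bySize (· < 2) : Finset (Finset α))) (fun S => S ∈ F)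
  simp only [RlumpVx]
  rw [h1, hxF, h2, h3, h4, hq, hc, ← hU', hN]
  linear_combination (gf U') * s1

/-- The C2 difference is symmetric in the pair. [this work] -/
theorem RlumpVx_two_sub_three_comm (D : Finset (Finset α)) :
    RlumpVx D F G v 2 - RlumpVx D F G v 3 = RlumpVx D G F v 2 - RlumpVx D G F v 3 := by
  simp only [RlumpVx]
  rw [inter_comm G F]
  ring

end Identities

end Summit.CriticalPhenomena.PercolationContinuityZ3.Theorems.SahiCTCForms
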